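import Literature.MathematicalPhysics.QuantumFieldTheory.Balaban1983to89.T3NontrivialityFromTiltLabels
import Literature.MathematicalPhysics.QuantumFieldTheory.Balaban1983to89.T3ContinuumLaw
import HarnessLib

/-!
# `Balaban1983to89.T3OSLawNontrivial` — rung R3 in LAW FORM with NON-TRIVIALITY, from K1 ∧ K2 ALONE: the unique OS-positive, torus-covariant,
# centre-symmetric continuum loop law of `SU(2)` YM₃ on a three-torus has NON-DEGENERATE, NON-GAUSSIAN marginals at every simple-loop label

Cell `ym3-torus` (HUMAN RULING D-0037, YM ladder rung R3), seat `ym3-torus-p2` gen 15 (HOME/IR-NODE.md §21).  WHAT THIS IS NOT: not d = 4, not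
infinite volume, not a mass gap, not Clay; `UnitTiltTail` (K1 ∧ K2 — the route's three load-bearing cruxes) is an OPEN hypothesis.  This is the
small-mass-free successor of gen 6's `T3OSLawNondegenerate.exists_osLaw_polyakov_nondegenerate`: there the Polyakov variance bound needed
`c + Σ(w + w') ≤ e^{−2Σr}/4`; here the rates are only summable (the hypotheses of existence), the labels are ALL once-visiting labels (every simple
loop; plaquettes and Polyakov lines by name), and the tilt may be that of a REFINEMENT `(F.refine n, γL^{-n})` — the shape the route delivers.

* `exists_osLaw_nontrivial_of_refine_unitTiltTail` — ONE law `ν` with `IsOSContinuumLaw3 F hE hγ ν` (weak limit of the loop laws along the full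
  sequence, uniqueness, moments, OS positivity on every strict cone, `T₁ ⋊ B₃` invariance), unique, centre-symmetric, and for EVERY label `C` whose
  unit-lattice representative visits some bond exactly once: `Var_ν(x_C) > 0` and the `C`-marginal is not Gaussian.
* `exists_osLaw_nontrivial_of_unitTiltTail` — the unrefined case.
* `osLaw_polyakov_nondegenerate_of_refine_unitTiltTail` — the Polyakov labels by name (plaquettes: instantiate the once-visiting clause with
  the split of `T3NontrivialityFromTiltRefine`/`…Labels`, or use `T3NontrivialityFromTilt.limitLoopLaw_plaquette_nondegenerate`).

References: A. Jaffe, E. Witten [JaffeWittenClay2006] (§4 p.6, §6.5 p.11); C. King [King1986] (Thm 3.4 p.656); S. Chatterjee [Chatterjee2019YMProbabilists]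
(§6 p.19); G. 't Hooft, Nucl. Phys. B 153 (1979) [tHooft1979Flux] (§2, centre symmetry); L. McLerran, B. Svetitsky [McLerranSvetitsky1981].
-/

noncomputable section

open MeasureTheory Filter Topology ProbabilityTheory Set
open scoped NNReal
open Literature.MathematicalPhysics.QuantumFieldTheory.Balaban1983to89
open Literature.MathematicalPhysics.QuantumFieldTheory.Balaban1983to89.Missing
open Literature.MathematicalPhysics.QuantumFieldTheory.Balaban1983to89.T4Continuum
open Literature.MathematicalPhysics.QuantumFieldTheory.Balaban1983to89.T4LimitLaw
open Literature.MathematicalPhysics.QuantumFieldTheory.Balaban1983to89.T3ContinuumYM3Torus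
open Literature.MathematicalPhysics.QuantumFieldTheory.Balaban1983to89.T3UnitScaleTilt
open Literature.MathematicalPhysics.QuantumFieldTheory.Balaban1983to89.T3UnitLawDensityEML (ℰp measurableE_ℰp)
open Literature.MathematicalPhysics.QuantumFieldTheory.Balaban1983to89.T3NontrivialityFromTilt
open Literature.MathematicalPhysics.QuantumFieldTheory.Balaban1983to89.T3NontrivialityFromTiltRefine
open Literature.MathematicalPhysics.QuantumFieldTheory.Balaban1983to89.T3NontrivialityFromTiltLabels

namespace Literature.MathematicalPhysics.QuantumFieldTheory.Balaban1983to89.T3OSLawNontrivial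

variable {r w w' : ℕ → ℝ}

/-- **THE OS CONTINUUM LAW FROM A REFINEMENT'S TILT: EXISTS, UNIQUE, CENTRE-SYMMETRIC, WITH NON-DEGENERATE NON-GAUSSIAN MARGINALS AT EVERY
ONCE-VISITING LABEL** (`SU(2)`, printed averaging, `γ ≥ 0`; `UnitTiltTail (F.refine n) ℰp (γL^{-n}) r w w'` with summable rates, NO smallness).
[cite: JaffeWittenClay2006, §6.5 p.11] -/
theorem exists_osLaw_nontrivial_of_refine_unitTiltTail (F : T3Family) (n : ℕ) {γ : ℝ} (hγ : 0 ≤ γ)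
    (h : UnitTiltTail (F.refine n) ℰp (γ * ((F.L : ℝ)⁻¹) ^ n) r w w') (hr : Summable r) (hw : Summable w) (hw' : Summable w') :
    ∃ ν : ProbabilityMeasure (Cube (ULoop3 F)), IsOSContinuumLaw3 F measurableE_ℰp hγ ν ∧
      (∀ ν' : ProbabilityMeasure (Cube (ULoop3 F)), IsOSContinuumLaw3 F measurableE_ℰp hγ ν' → ν' = ν) ∧
      (∀ μ : Fin 3, (ν : Measure (Cube (ULoop3 F))).map (centreFlip μ) = ν) ∧
      ∀ (C : ULoop3 F) (γ₁ γ₂ : List (LStep (F.P 0) 0)) (s : LStep (F.P 0) 0), C.1.atLevel 0 = γ₁ ++ s :: γ₂ →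
        (∀ s' ∈ γ₁, s'.bond ≠ s.bond) → (∀ s' ∈ γ₂, s'.bond ≠ s.bond) →
          0 < Var[fun y => ((y C : Set.Icc (-1 : ℝ) 1) : ℝ); (ν : Measure (Cube (ULoop3 F)))] ∧
          ∀ (m : ℝ) (v : ℝ≥0), (ν : Measure (Cube (ULoop3 F))).map (fun y => ((y C : Set.Icc (-1 : ℝ) 1) : ℝ)) ≠ gaussianReal m v := by
  have hlim : HasContinuumLimit (F.scheme ℰp γ) := hasContinuumLimit_of_refine_unitTiltTail measurableE_ℰp n hγ hr hw hw' h
  have hY : ContinuumYM3Torus F ℰp γ := continuumYM3Torus_of_refine_unitTiltTail F ℰp measurableE_ℰp n hγ hr hw hw' h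
  obtain ⟨ν, hν, huniq⟩ := (continuumYM3Torus_iff_existsUnique_osLaw F measurableE_ℰp hγ).mp hY
  refine ⟨ν, hν, fun ν' hν' => huniq ν' hν', fun μ => IsOSContinuumLaw3.centreFlip_invariant F measurableE_ℰp hγ hν μ, fun C γ₁ γ₂ s hC h₁ h₂ => ?_⟩
  obtain ⟨c, hc⟩ := exists_uniformVariance_of_refine_unitTiltTail_of_split F n hγ h hr hw hw' C γ₁ γ₂ s hC h₁ h₂
  obtain ⟨ν', hν', -, hvar, hng⟩ := limitLoopLaw_nondegenerate F measurableE_ℰp hγ hlim hc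
  have heq : ν' = ν := huniq ν' ((isOSContinuumLaw3_iff_tendsto ν').mpr hν')
  subst heq
  exact ⟨hc.1.trans_le hvar, hng⟩

/-- **THE UNREFINED CASE**: `UnitTiltTail F ℰp γ r w w'` with summable rates ⇒ the same package (`F.refine 0` is not used: direct proof).
[cite: JaffeWittenClay2006, §6.5 p.11] -/
theorem exists_osLaw_nontrivial_of_unitTiltTail (F : T3Family) {γ : ℝ} (hγ : 0 ≤ γ) (h : UnitTiltTail F ℰp γ r w w')
    (hr : Summable r) (hw : Summable w) (hw' : Summable w') :
    ∃ ν : ProbabilityMeasure (Cube (ULoop3 F)), IsOSContinuumLaw3 F measurableE_ℰp hγ ν ∧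
      (∀ ν' : ProbabilityMeasure (Cube (ULoop3 F)), IsOSContinuumLaw3 F measurableE_ℰp hγ ν' → ν' = ν) ∧
      (∀ μ : Fin 3, (ν : Measure (Cube (ULoop3 F))).map (centreFlip μ) = ν) ∧
      ∀ (C : ULoop3 F) (γ₁ γ₂ : List (LStep (F.P 0) 0)) (s : LStep (F.P 0) 0), C.1.atLevel 0 = γ₁ ++ s :: γ₂ →
        (∀ s' ∈ γ₁, s'.bond ≠ s.bond) → (∀ s' ∈ γ₂, s'.bond ≠ s.bond) →
          0 < Var[fun y => ((y C : Set.Icc (-1 : ℝ) 1) : ℝ); (ν : Measure (Cube (ULoop3 F)))] ∧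
          ∀ (m : ℝ) (v : ℝ≥0), (ν : Measure (Cube (ULoop3 F))).map (fun y => ((y C : Set.Icc (-1 : ℝ) 1) : ℝ)) ≠ gaussianReal m v := by
  have hlim : HasContinuumLimit (F.scheme ℰp γ) := hasContinuumLimit_of_unitTiltTail measurableE_ℰp hγ hr hw hw' h
  have hY : ContinuumYM3Torus F ℰp γ := continuumYM3Torus_of_unitTiltTail F ℰp measurableE_ℰp hγ hr hw hw' h
  obtain ⟨ν, hν, huniq⟩ := (continuumYM3Torus_iff_existsUnique_osLaw F measurableE_ℰp hγ).mp hY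
  refine ⟨ν, hν, fun ν' hν' => huniq ν' hν', fun μ => IsOSContinuumLaw3.centreFlip_invariant F measurableE_ℰp hγ hν μ, fun C γ₁ γ₂ s hC h₁ h₂ => ?_⟩
  obtain ⟨c, hc⟩ := exists_uniformVariance_of_unitTiltTail_of_split F hγ h hr hw hw' C γ₁ γ₂ s hC h₁ h₂
  obtain ⟨ν', hν', -, hvar, hng⟩ := limitLoopLaw_nondegenerate F measurableE_ℰp hγ hlim hc
  have heq : ν' = ν := huniq ν' ((isOSContinuumLaw3_iff_tendsto ν').mpr hν')
  subst heq
  exact ⟨hc.1.trans_le hvar, hng⟩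

/-- **THE POLYAKOV MARGINALS BY NAME** (from a refinement's tilt): the OS continuum law gives every `polyakov μ x` positive variance and a
non-Gaussian marginal; its MEAN is `0` by centre symmetry (`T3CentreSymmetry.limit_polyakov_eq_zero`; law form = the `centreFlip` invariance of
`exists_osLaw_nontrivial_of_refine_unitTiltTail`). [cite: McLerranSvetitsky1981] -/
theorem osLaw_polyakov_nondegenerate_of_refine_unitTiltTail (F : T3Family) (n : ℕ) {γ : ℝ} (hγ : 0 ≤ γ)
    (h : UnitTiltTail (F.refine n) ℰp (γ * ((F.L : ℝ)⁻¹) ^ n) r w w') (hr : Summable r) (hw : Summable w) (hw' : Summable w')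
    (μ : Fin 3) (x : F.USite) :
    ∃ ν : ProbabilityMeasure (Cube (ULoop3 F)), IsOSContinuumLaw3 F measurableE_ℰp hγ ν ∧
      0 < Var[fun y => ((y (ULoop3.polyakov μ x) : Set.Icc (-1 : ℝ) 1) : ℝ); (ν : Measure (Cube (ULoop3 F)))] ∧
      ∀ (m : ℝ) (v : ℝ≥0), (ν : Measure (Cube (ULoop3 F))).map
        (fun y => ((y (ULoop3.polyakov μ x) : Set.Icc (-1 : ℝ) 1) : ℝ)) ≠ gaussianReal m v := by
  obtain ⟨ν, hν, -, -, hall⟩ := exists_osLaw_nontrivial_of_refine_unitTiltTail F n hγ h hr hw hw'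
  obtain ⟨γ₂, hC, h₂⟩ := polyakov_atLevel_split (F := F) μ x
  obtain ⟨hvar, hng⟩ := hall (ULoop3.polyakov μ x) [] γ₂ _ hC (fun s' hs' => by simp at hs') h₂
  exact ⟨ν, hν, hvar, hng⟩

end Literature.MathematicalPhysics.QuantumFieldTheory.Balaban1983to89.T3OSLawNontrivial

end
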